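import Literature.NumberTheory.PAdicHodge.BmaxPlusToBdR
import Literature.NumberTheory.PAdicHodge.BmaxPlusFormalLogTatePeriods
import Literature.NumberTheory.PAdicHodge.BmaxPlusFrobeniusEigenTeichLog
import Literature.RingTheory.FormalGroups.PadicLogTypeSeriesDeterminant
import HarnessLib

/-!
# Values of the comparison `B_max⁺ → B_dR⁺` on the φ-road periods: formal logarithms, Tate-module periods, and `(A_max)^{φ=p}`

Topic `Literature/NumberTheory/PAdicHodge`; namespace `Literature.NumberTheory.PAdicHodge`. THEOREMS ONLY (no definition, no named fact, no
instance, no `sorry`). With the honest ring homomorphism `bmaxPlusToBdR : B_max⁺(F) → B_dR⁺(F)` (`BmaxPlusToBdR`) the «modulo every `Fil^k`» results of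
`BmaxPlusBdRModFil*`, `BmaxPlusFormalLogTatePeriods` and `BmaxPlusFrobeniusEigenTeichLog` become statements about honest elements of `B_dR⁺`:

* `eq_of_forall_sub_mem_span_xiBdR_pow` — `B_dR⁺` is `ξ`-adically separated;
* ★ `exists_forall_isLogTypeModFil_bmaxPlusToBdR_logSum` — the image of the `A_max`-valued sum `Λᵇ_N(ι y₀, z) = p^N·ℓ_b(y₀)` is `p^N·L′` with ONE `L′`
  satisfying `IsLogTypeModFil b k y₀ L′` for EVERY `k` (honest value of `ℓ_b(ι y₀)` in `B_dR⁺`); `…isFormalLogModFil…` (`b = formalLogNum W p`);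
* ★★ `bmaxPlusToBdR_logSum_divisionLiftPt_torsion` — for a TORSION sequence `v`: **`bmaxPlusToBdR (Λ_N(ι[ṽ], z)) = p^N · ∫_v ω`** EXACTLY
  (K1's `omegaPeriod`); `bmaxPlusToBdR_logSum_torsionLiftHom` (the `T_pŴ`-form with `omegaPeriodHom`, `N = 1`);
* ★★ `isTeichLog_pow_mul_bmaxPlusToBdR` — `φx = p·x ⟹ IsTeichLog k (p^M · bmaxPlusToBdR x)` (edix-p1's FES fragment, all `k ≥ 1`);
* ★ `exists_sq_mul_bmaxPlusToBdR_eq_smul_tBdR` — `φx = p·x ∧ θx = 0 ⟹ p²·bmaxPlusToBdR x = λ·t_dR` (Fontaine's lemma `BmaxPlusTDivisibilityAllPrimes`);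
* ★★★ `isTeichLog_pow_mul_bmaxPlusToBdR_det_of_honda` — for a Honda pair `Λ, Λ′` (`φ²X − aφX + pX = 0`): the honest Legendre resolution
  `D_dR := bmaxPlusToBdR(Λ)·bmaxPlusToBdR(φΛ′) − bmaxPlusToBdR(φΛ)·bmaxPlusToBdR(Λ′)` has **`IsTeichLog k (p^M·D_dR)`** — the socket's (K₂) with honest
  elements, no «any limits» bookkeeping.

B8b of the φ-road of line `kato_lever` (crux K★ `stmt-BirchSwinnertonDyer-22226`, memo
`Summits/…/Cruxes/StarredOptimalManinUnitFiveSeven/Lines/kato-lever-K2-tower-instantiation.md`). Infrastructure only; BSD / K★ are not proved by any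
of this.

## References
* [Colmez1998Annals] P. Colmez, *Théorie d'Iwasawa des représentations de de Rham d'un corps local*, Ann. of Math. 148 (1998), §III.2–III.3.
* [FontaineOuyang2022] J.-M. Fontaine, Y. Ouyang, *Theory of p-adic Galois representations*, §6.1.
* [Fontaine1982FormesDifferentielles] J.-M. Fontaine, Invent. Math. 65 (1982), §5.
-/

noncomputable section

open WittVector Field ValuativeRel
open Literature.AlgebraicGeometry.Resolution
open Literature.RingTheory.FormalGroups

namespace Literature.NumberTheory.PAdicHodge

open Literature.NumberTheory.GaloisRepresentations
open Literature.NumberTheory.GaloisRepresentations.IsNonarchimedeanLocalField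
open Literature.NumberTheory.GaloisRepresentations.LubinTate Literature.NumberTheory.EllipticCurves
open GaloisContinuity

variable {F : Type} [Field F] [ValuativeRel F] [TopologicalSpace F] [IsNonarchimedeanLocalField F]
  [CharZero F] {p : ℕ} [Fact p.Prime] [Fact (¬ IsUnit (p : integerC F))]
  [IsAdicComplete (Ideal.span {(p : integerC F)}) (integerC F)]

/-! ## §1 Separatedness -/

/-- **`B_dR⁺` is `ξ`-adically separated**: if `a − b ∈ ξ^k B_dR⁺` for every `k` then `a = b`. [cite: Colmez1998Annals, §III.2] -/
theorem eq_of_forall_sub_mem_span_xiBdR_pow {a b : BDeRhamPlus (integerC F) p}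
    (h : ∀ k : ℕ, a - b ∈ Ideal.span {(xiBdR : BDeRhamPlus (integerC F) p) ^ k}) : a = b := by
  haveI := isAdicComplete_span_xiBdR (F := F) (p := p)
  refine sub_eq_zero.1 (IsHausdorff.haus (IsAdicComplete.toIsHausdorff (I := Ideal.span {(xiBdR : BDeRhamPlus (integerC F) p)})) (a - b)
    fun k => ?_)
  rw [smul_eq_mul, Ideal.mul_top, Ideal.span_singleton_pow, SModEq.zero]
  exact h k

/-! ## §2 Formal-group logarithms: one honest value for all `k` -/

set_option maxHeartbeats 1600000 in
/-- ★ **The image of `Λᵇ_N(ι y₀, z)` is `p^N·L′` with `IsLogTypeModFil b k y₀ L′` for EVERY `k`** (`y₀ ∈ 𝔸_inf` `p`-nilpotent of index `N ≥ 1` in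
`B⁰_max`): the honest `B_dR⁺`-value of `ℓ_b(ι y₀)` (`BmaxPlusBdRModFilLogType.exists_isLogTypeModFil_of_bdR_lim_modFil_logSum` at each `k`, and `p^N` is a
unit of `B_dR⁺`). [cite: Colmez1998Annals, §III.2] [cite: Fontaine1982FormesDifferentielles, §5] -/
theorem exists_forall_isLogTypeModFil_bmaxPlusToBdR_logSum (b : ℕ → ℤ_[p]) {N : ℕ} (hN : 1 ≤ N) (y₀ : Ainf (p := p) F)
    {z : bmaxZero F p} (hz : algebraMap (Ainf (p := p) F) (bmaxZero F p) y₀ ^ N = (p : bmaxZero F p) * z) :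
    ∃ L' : BDeRhamPlus (integerC F) p,
      (p : BDeRhamPlus (integerC F) p) ^ N * L' =
        bmaxPlusToBdR F p (PadicLogSeries.logSum ((algebraMap (Ainf (p := p) F) (bmaxZero F p)).comp zpToAinf) b N
          (algebraMap (Ainf (p := p) F) (bmaxZero F p) y₀) z) ∧
      ∀ k : ℕ, IsLogTypeModFil b k y₀ L' := by
  set Λ := PadicLogSeries.logSum ((algebraMap (Ainf (p := p) F) (bmaxZero F p)).comp zpToAinf) b N
    (algebraMap (Ainf (p := p) F) (bmaxZero F p) y₀) z with hΛ
  have hk : ∀ k : ℕ, ∃ L' : BDeRhamPlus (integerC F) p, (p : BDeRhamPlus (integerC F) p) ^ N * L' = bmaxPlusToBdR F p Λ ∧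
      IsLogTypeModFil b k y₀ L' := fun k => by
    obtain ⟨r, h⟩ := isBdRLimModFil_bmaxPlusToBdR Λ k
    exact exists_isLogTypeModFil_of_bdR_lim_modFil_logSum b hN y₀ hz h
  choose Lk hLk hLk' using hk
  have hu : IsUnit ((p : BDeRhamPlus (integerC F) p) ^ N) := (isUnit_natCast_bDeRhamPlus (F := F) (p := p) (Fact.out : p.Prime).ne_zero).pow N
  refine ⟨Lk 0, hLk 0, fun k => ?_⟩
  have heq : Lk k = Lk 0 := hu.mul_left_cancel ((hLk k).trans (hLk 0).symm)
  rw [← heq]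
  exact hLk' k

/-- The same for `b = formalLogNum W p`: **`bmaxPlusToBdR (Λ^W_N(ι x₀, z)) = p^N·L′` with `IsFormalLogModFil W k x₀ L′` for every `k`** — the honest
value of `log_W(ι x₀)` in `B_dR⁺`. [cite: Fontaine1982FormesDifferentielles, §5] -/
theorem exists_forall_isFormalLogModFil_bmaxPlusToBdR_logSum (W : WeierstrassCurve ℤ) {N : ℕ} (hN : 1 ≤ N) (x₀ : Ainf (p := p) F)
    {z : bmaxZero F p} (hz : algebraMap (Ainf (p := p) F) (bmaxZero F p) x₀ ^ N = (p : bmaxZero F p) * z) :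
    ∃ L' : BDeRhamPlus (integerC F) p,
      (p : BDeRhamPlus (integerC F) p) ^ N * L' =
        bmaxPlusToBdR F p (PadicLogSeries.logSum ((algebraMap (Ainf (p := p) F) (bmaxZero F p)).comp zpToAinf) (formalLogNum W p) N
          (algebraMap (Ainf (p := p) F) (bmaxZero F p) x₀) z) ∧
      ∀ k : ℕ, IsFormalLogModFil W k x₀ L' :=
  exists_forall_isLogTypeModFil_bmaxPlusToBdR_logSum (formalLogNum W p) hN x₀ hz

/-! ## §3 Tate-module periods: `bmaxPlusToBdR (L_v) = p^N · ∫_v ω` -/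

set_option maxHeartbeats 1600000 in
/-- ★★ **`bmaxPlusToBdR (Λ_N(ι[ṽ], z)) = p^N·∫_v ω`** for a TORSION sequence `v` of `Ŵ(𝔪_{ℂ_F})` (`v₀ = 0`; `∫_v ω = omegaPeriod`, K1's honest
`ξ`-adic period): the comparison agrees with it modulo every `Fil^k` (`BmaxPlusFormalLogTatePeriods`), and `B_dR⁺` is separated.
[cite: Fontaine1982FormesDifferentielles, §5] [cite: Colmez1998Annals, §III.2] -/
theorem bmaxPlusToBdR_logSum_divisionLiftPt_torsion (W : WeierstrassCurve ℤ) {hθ : Function.Surjective (fontaineTheta (integerC F) p)}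
    {t : ℕ → (maxNilIdealC F).toIdeal} (ht0 : ((t 0 : (maxNilIdealC F).toIdeal) : CBall F) = 0)
    (htp : ∀ n, AinfTop.mulPC F p W (t (n + 1)) = t n) {N : ℕ} (hN : 1 ≤ N) {z : bmaxZero F p}
    (hz : algebraMap (Ainf (p := p) F) (bmaxZero F p)
        ((AinfTop.of F p).symm (((AinfTop.divisionLiftPt W hθ t htp).val : (AinfTop.nilTheta F p hθ).toIdeal) : AinfTop F p)) ^ N =
      (p : bmaxZero F p) * z) :
    bmaxPlusToBdR F p
        (PadicLogSeries.logSum ((algebraMap (Ainf (p := p) F) (bmaxZero F p)).comp zpToAinf) (formalLogNum W p) N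
          (algebraMap (Ainf (p := p) F) (bmaxZero F p)
            ((AinfTop.of F p).symm (((AinfTop.divisionLiftPt W hθ t htp).val : (AinfTop.nilTheta F p hθ).toIdeal) : AinfTop F p))) z) =
      (p : BDeRhamPlus (integerC F) p) ^ N * (BdRPlusTop.of F p).symm (AinfTop.omegaPeriod W hθ t ht0 htp) := by
  refine eq_of_forall_sub_mem_span_xiBdR_pow fun k => ?_
  obtain ⟨r, h⟩ := isBdRLimModFil_bmaxPlusToBdR (PadicLogSeries.logSum ((algebraMap (Ainf (p := p) F) (bmaxZero F p)).comp zpToAinf)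
    (formalLogNum W p) N (algebraMap (Ainf (p := p) F) (bmaxZero F p)
      ((AinfTop.of F p).symm (((AinfTop.divisionLiftPt W hθ t htp).val : (AinfTop.nilTheta F p hθ).toIdeal) : AinfTop F p))) z) k
  exact AinfTop.sub_pow_mul_omegaPeriod_mem_of_bdR_lim_modFil_logSum W ht0 htp hN hz h

set_option maxHeartbeats 1600000 in
/-- **`bmaxPlusToBdR (Λ_1(ι[τ̃], z)) = p · ∫_τ ω`** for `τ ∈ T_pŴ(𝒪_{ℂ_F})` (`omegaPeriodHom`; `[τ̃] = torsionLiftHom τ`): on the Tate module the φ-road's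
`Pω` IS the socket's `∫ ω`, up to the factor `p`. [cite: Fontaine1982FormesDifferentielles, §5] [cite: Colmez1998Annals, §III.2] -/
theorem bmaxPlusToBdR_logSum_torsionLiftHom (W : WeierstrassCurve ℤ) {hθ : Function.Surjective (fontaineTheta (integerC F) p)}
    (τ : AinfTop.TatePt F p W) {z : bmaxZero F p}
    (hz : algebraMap (Ainf (p := p) F) (bmaxZero F p)
        ((AinfTop.of F p).symm (((AinfTop.torsionLiftHom W hθ τ).val : (AinfTop.nilTheta F p hθ).toIdeal) : AinfTop F p)) ^ 1 =
      (p : bmaxZero F p) * z) :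
    bmaxPlusToBdR F p
        (PadicLogSeries.logSum ((algebraMap (Ainf (p := p) F) (bmaxZero F p)).comp zpToAinf) (formalLogNum W p) 1
          (algebraMap (Ainf (p := p) F) (bmaxZero F p)
            ((AinfTop.of F p).symm (((AinfTop.torsionLiftHom W hθ τ).val : (AinfTop.nilTheta F p hθ).toIdeal) : AinfTop F p))) z) =
      (p : BDeRhamPlus (integerC F) p) * (BdRPlusTop.of F p).symm (AinfTop.omegaPeriodHom W hθ τ) := by
  have h := bmaxPlusToBdR_logSum_divisionLiftPt_torsion W (hθ := hθ) (AinfTop.seq_zero W τ) (AinfTop.mulPC_seq W τ) le_rfl hz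
  rw [pow_one] at h
  rw [AinfTop.omegaPeriodHom_apply]
  exact h

/-! ## §4 `(A_max)^{φ=p}` under the comparison -/

set_option maxHeartbeats 1600000 in
/-- ★★ **`φx = p·x ⟹ IsTeichLog k (p^M · bmaxPlusToBdR x)`** for some `M` (every `k ≥ 1`): the image of `(A_max)^{φ=p}` in `B_dR⁺` is contained in
`ℚ_p ⊗ X⁰_k` for every `k` (`BmaxPlusFrobeniusEigenTeichLog.isTeichLog_pow_mul_of_bdR_lim_modFil_of_frobBmaxPlus_eq`, Fontaine's
`(B⁺_cris)^{φ=p} ⊆ ℚ_p ⊗ log[1 + 𝔪♭]`). [cite: FontaineOuyang2022, §6.1] [cite: Colmez1998Annals, §III.3] -/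
theorem isTeichLog_pow_mul_bmaxPlusToBdR (hF : Function.Surjective (fontaineTheta (integerC F) p)) (hpv : valuation F p < 1) {k : ℕ}
    (hk : 1 ≤ k) {x : BmaxPlus F p} (hx : frobBmaxPlus F p x = (p : BmaxPlus F p) * x) :
    ∃ M : ℕ, IsTeichLog k ((p : BDeRhamPlus (integerC F) p) ^ M * bmaxPlusToBdR F p x) := by
  obtain ⟨r, h⟩ := isBdRLimModFil_bmaxPlusToBdR x k
  exact isTeichLog_pow_mul_of_bdR_lim_modFil_of_frobBmaxPlus_eq hF hpv hk hx h

/-- ★ **`φx = p·x ∧ θx = 0 ⟹ p²·bmaxPlusToBdR x = λ·t_dR`** (`λ ∈ ℤ_p`): Fontaine's lemma (`exists_sq_mul_eq_zpToAinf_mul_tBmax'`) transported by the ring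
map `bmaxPlusToBdR` (`t ↦ t_dR`, `ι(λ) ↦ qpToBdR λ`). [cite: Colmez1998Annals, §III.3] [cite: FontaineOuyang2022, §6.1] -/
theorem exists_sq_mul_bmaxPlusToBdR_eq_smul_tBdR (hF : Function.Surjective (fontaineTheta (integerC F) p)) {x : BmaxPlus F p}
    (hx : frobBmaxPlus F p x = (p : BmaxPlus F p) * x) (hθ : thetaBmaxPlus F p x = 0) :
    ∃ lam : ℤ_[p], (p : BDeRhamPlus (integerC F) p) ^ 2 * bmaxPlusToBdR F p x = qpToBdR (lam : ℚ_[p]) * tBdR := by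
  obtain ⟨lam, h⟩ := exists_sq_mul_eq_zpToAinf_mul_tBmax' hF hx hθ
  refine ⟨lam, ?_⟩
  have h2 := congrArg (bmaxPlusToBdR F p) h
  rwa [map_mul, map_pow, map_natCast, map_mul, bmaxPlusToBdR_tBmax, bmaxPlusToBdR_ainfToBmaxPlus_zpToAinf] at h2

/-! ## §5 (K₂) for a Honda pair, with honest elements -/

set_option maxHeartbeats 1600000 in
/-- ★★★ **(K₂) with honest elements.** Let `Λ, Λ′ ∈ A_max` satisfy `φ²X − a·φX + p·X = 0` (e.g. the `A_max`-periods of two `[p]_W`-division sequences,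
`BmaxPlusFormalLogDivisionTower`). Then the honest Legendre resolution `D_dR = bmaxPlusToBdR(Λ)·bmaxPlusToBdR(φΛ′) − bmaxPlusToBdR(φΛ)·bmaxPlusToBdR(Λ′) ∈ B_dR⁺`
satisfies **`IsTeichLog k (p^M·D_dR)`** for some `M` (every `k ≥ 1`): `D = Λ·φΛ′ − φΛ·Λ′ ∈ (A_max)^{φ=p}` (`PadicLogSeries.frob_det_eq_mul_det`) and
`isTeichLog_pow_mul_bmaxPlusToBdR`. This is the socket's `KTwoMembership` shape with `b_ω, b_η, P_ω, P_η` the HONEST images of `Λ, φΛ, Λ′, φΛ′`.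
[cite: FontaineOuyang2022, §6.1] [cite: Colmez1998Annals, §III.3] -/
theorem isTeichLog_pow_mul_bmaxPlusToBdR_det_of_honda (hF : Function.Surjective (fontaineTheta (integerC F) p)) (hpv : valuation F p < 1)
    {k : ℕ} (hk : 1 ≤ k) {a Λ Λ' : BmaxPlus F p}
    (hΛ : frobBmaxPlus F p (frobBmaxPlus F p Λ) - a * frobBmaxPlus F p Λ + (p : BmaxPlus F p) * Λ = 0)
    (hΛ' : frobBmaxPlus F p (frobBmaxPlus F p Λ') - a * frobBmaxPlus F p Λ' + (p : BmaxPlus F p) * Λ' = 0) :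
    ∃ M : ℕ, IsTeichLog k ((p : BDeRhamPlus (integerC F) p) ^ M *
      (bmaxPlusToBdR F p Λ * bmaxPlusToBdR F p (frobBmaxPlus F p Λ') - bmaxPlusToBdR F p (frobBmaxPlus F p Λ) * bmaxPlusToBdR F p Λ')) := by
  have hD : frobBmaxPlus F p (Λ * frobBmaxPlus F p Λ' - frobBmaxPlus F p Λ * Λ') =
      (p : BmaxPlus F p) * (Λ * frobBmaxPlus F p Λ' - frobBmaxPlus F p Λ * Λ') :=
    PadicLogSeries.frob_det_eq_mul_det (frobBmaxPlus F p) hΛ hΛ'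
  obtain ⟨M, hM⟩ := isTeichLog_pow_mul_bmaxPlusToBdR hF hpv hk hD
  refine ⟨M, ?_⟩
  rwa [map_sub, map_mul, map_mul] at hM

end Literature.NumberTheory.PAdicHodge

end
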